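import Literature.NumberTheory.IwasawaTheory.UnramifiedHomsZpTowerFinite
import Literature.NumberTheory.NumberFields.EquivariantUnramifiedHomsAbsoluteCount
import HarnessLib

/-!
# Everywhere-unramified `Gal(K̄/K_∞)`-EQUIVARIANT homomorphisms on `Gal(K̄/L·K_∞)` with values in a
# `p`-torsion `Γ_K`-module are FINITE when the numbers of `Gal(L·K_n/K_n)`-equivariant additive maps
# `Cl(L·K_n) → M` are bounded along the tower (proved; no definition, no named fact)

`Proofs`-style file in topic `NumberTheory/IwasawaTheory` (namespace
`Literature.NumberTheory.IwasawaTheory.EquivariantUnramifiedHomsZpTowerFinite`), written by the literature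
seat `bsd-potss-conjA-anchor` g19 (cell `bsd-potss`; serves the asides stmt-BirchSwinnertonDyer-19386 /
19413; closes nothing).  EQUIVARIANT refinement of the sibling `UnramifiedHomsZpTowerFinite` (seat
k8t-c4 g21), whose §1–§4 (common open normal subgroup, decomposition layer, extension, absorption of the
ramification above `p`) are reused verbatim; third brick of the cell's ISOTYPIC BOUNDED-MULTIPLICITY
criterion for Coates–Sujatha's Conjecture A (the `λ`-tolerant form of [CoatesSujatha2005] Lemma 3.8 /
Thm. 3.4), assembled in the `EllipticCurves` sibling.

Setting: `K` a number field, `p` an odd prime, `κ` a `ℤ_p`-extension of `K` (`H = ker κ = Gal(K̄/K_∞)`,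
layers `κ.layerSubgroup n = Gal(K̄/K_n)`), `N = Gal(K̄/L) ≤ Γ_K` open normal (`L/K` finite Galois),
`U_n = N ⊓ Gal(K̄/K_n) = Gal(K̄/L·K_n)`, `U_∞ = N ⊓ H`, and `M` a finite `Γ_K`-module with `p·M = 0` on
which `N` acts trivially.

* §1 `exists_level_forall_exists_mul_mem_kerSubgroup` — from some layer `t'` on, every `γ ∈ Gal(K̄/K_m)`
  is `γ₀ w` with `γ₀ ∈ H` and `w ∈ U_m` (`κ(N)` is open in `ℤ_p`: the sibling's §2 with the roles
  `(N, V) := (Γ_K, N)`).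
* §2 `extension_equivariant` — at such a layer, the additive extension `g : U_m → M` of an `H`-EQUIVARIANT
  (`f(huh⁻¹) = h • f(u)`) additive `f : U_∞ → M` produced by the sibling's §3 is `Gal(K̄/K_m)`-equivariant:
  for `γ = γ₀ w`, `u = u'v`: `g(γuγ⁻¹) = f(γu'γ⁻¹) = γ₀ • f(wu'w⁻¹) = γ₀ • f(u') = γ • g(u)` (`f(wu'w⁻¹) =
  g(w) + g(u') − g(w)`; `w ∈ N` acts trivially on `M`).
* §3 **`finsetCard_le_of_subset_equivariantUnramifiedHoms`** — if for every `n` the number of additive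
  maps `μ : Cl(𝓞_{F_n}) → M` (`F_n = K̄^{U_n} = L·K_n`, Galois over `K`) that are equivariant under
  `Gal(K̄/K_n)` (`μ(γ|_{F_n} · c) = γ • μ(c)`; through `Gal(F_n/K_n) ≅ Gal(L/L ∩ K_n)`) is `≤ C`, then
  every finite set of `H`-equivariant members of `unramifiedHoms (N ⊓ ker κ) M ∅` has at most `C` elements;
  hence (`equivariantUnramifiedHoms_finite_of_card_le`) that set is finite.  Proof: the sibling's §1–§4 extend
  the members injectively to additive maps on `U_{m*}` killing an open normal subgroup and every inertia
  group; by §2 they are `Gal(K̄/K_{m*})`-equivariant; the EQUIVARIANT class-field-theoretic count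
  `EquivariantUnramifiedDescent.card_le_card_equivariantHom_classGroup_of_unramified` bounds them.

This is the finite-level content of «`μ_ρ̄(X_nr(L_∞)) = 0 ⟹ Hom_G(X_nr(L_∞)/p, ρ̄)` finite» in the
ISOTYPIC reading (Lim, *Notes on the fine Selmer groups*, §3) of the proof of Coates–Sujatha's Thm. 3.4 /
Lemma 3.8: `G`-equivariant unramified `ρ̄`-valued characters of `Gal(K̄/L_∞)` are controlled by the
`ρ̄`-multiplicities of the class groups of the layers `L_n`.

References: [CoatesSujatha2005] §3 Lemma 3.8, Thm. 3.4 (and its proof); [KuriharaPollack2007] §3.1;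
[Washington1997] §13.1 (Prop. 13.2, Lemma 13.3); [SerreGaloisCohomology1997] I.§2.2 Prop. 8.
-/

set_option autoImplicit false

noncomputable section

open scoped Classical Pointwise NumberField
open NumberField IsDedekindDomain Field IntermediateField

namespace Literature.NumberTheory.IwasawaTheory.EquivariantUnramifiedHomsZpTowerFinite

open Literature.NumberTheory.EllipticCurves Literature.NumberTheory.GaloisRepresentations
  Literature.NumberTheory.NumberFields Literature.NumberTheory.IwasawaTheory.UnramifiedHomsZpTowerFinite

variable {K : Type} [Field K] [NumberField K] {p : ℕ} [Fact p.Prime] (κ : ZpExtension K p)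
  (N : Subgroup (absoluteGaloisGroup K))

/-! ## §0 The fixed fields `F_n = K̄^{N ∩ κ⁻¹(pⁿℤ_p)}` are Galois over `K` -/

omit [NumberField K] [Fact p.Prime] in
/-- `K̄^{U}` is finite Galois over `K` for an open normal `U ≤ Γ_K` (Krull's Galois correspondence: open normal
subgroups of `Γ_K` cut out finite Galois subextensions of `K̄/K`).
[cite: NeukirchANT1999, Ch. IV §1 Thm. (1.2) (Krull: closed (normal) subgroups ↔ (Galois) subextensions)] -/
theorem isGalois_fixedField_of_isOpen [CharZero K] (U : Subgroup (absoluteGaloisGroup K)) [hUn : U.Normal]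
    (hU : IsOpen (U : Set (absoluteGaloisGroup K))) :
    IsGalois K (fixedField U : IntermediateField K (AlgebraicClosure K)) := by
  haveI : Algebra.IsAlgebraic K (AlgebraicClosure K) := AlgebraicClosure.isAlgebraic K
  haveI : IsGalois K (AlgebraicClosure K) := {}
  rw [← InfiniteGalois.normal_iff_isGalois, fixingSubgroup_fixedField_of_isOpen U hU]
  exact hUn

omit [NumberField K] in
/-- `F_n = K̄^{N ∩ κ⁻¹(pⁿℤ_p)} = L·K_n` is finite Galois over `K`. [cite: Washington1997, §13.1 (the layers `LK_n`)] -/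
theorem isGalois_fixedField_inf_layerSubgroup [CharZero K] [N.Normal] (hN : IsOpen (N : Set (absoluteGaloisGroup K)))
    (n : ℕ) : IsGalois K (fixedField (N ⊓ κ.layerSubgroup n) : IntermediateField K (AlgebraicClosure K)) :=
  isGalois_fixedField_of_isOpen (N ⊓ κ.layerSubgroup n) (hN.inter (κ.isOpen_layerSubgroup n))

/-! ## §1 The decomposition `Gal(K̄/K_m) = Gal(K̄/K_∞) · U_m` from some layer on -/

omit [NumberField K] in
/-- There is a layer `t'` such that for `m ≥ t'` every `γ ∈ Gal(K̄/K_m)` is `γ₀ w` with `γ₀ ∈ Gal(K̄/K_∞)`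
and `w ∈ N ∩ Gal(K̄/K_m)` (i.e. `κ(N) ⊇ p^{t'} ℤ_p`). [cite: Washington1997, §13.1 Lemma 13.3] -/
theorem exists_level_forall_exists_mul_mem_kerSubgroup [CharZero K] [N.Normal]
    (hN : IsOpen (N : Set (absoluteGaloisGroup K))) :
    ∃ t' : ℕ, ∀ m, t' ≤ m → ∀ γ ∈ κ.layerSubgroup m,
      ∃ w ∈ N ⊓ κ.layerSubgroup m, γ * w⁻¹ ∈ κ.kerSubgroup := by
  have htop : IsOpen ((⊤ : Subgroup (absoluteGaloisGroup K)) : Set (absoluteGaloisGroup K)) := by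
    rw [Subgroup.coe_top]; exact isOpen_univ
  obtain ⟨t', ht'⟩ := exists_level_forall_exists_apply_eq κ (⊤ : Subgroup (absoluteGaloisGroup K)) htop N hN
  refine ⟨t', fun m hm γ hγ => ?_⟩
  obtain ⟨w, hw, hwγ⟩ := ht' m hm γ (Subgroup.mem_inf.2 ⟨Subgroup.mem_top γ, hγ⟩)
  have hwN : w ∈ N := (Subgroup.mem_inf.1 hw).1
  have hwm : w ∈ κ.layerSubgroup m := by
    rw [ZpExtension.mem_layerSubgroup] at hγ ⊢
    rw [hwγ]; exact hγ
  refine ⟨w, Subgroup.mem_inf.2 ⟨hwN, hwm⟩, ?_⟩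
  rw [ZpExtension.mem_kerSubgroup, map_mul, map_inv, hwγ, mul_inv_cancel]

/-! ## §2 The extension of an `H`-equivariant homomorphism is `Gal(K̄/K_m)`-equivariant -/

omit [NumberField K] in
/-- **Equivariance of the extension.**  `V ≤ Γ_K` normal, `M` a `Γ_K`-module on which `N` acts trivially,
`f : U_∞ → M` equivariant under conjugation by `H = Gal(K̄/K_∞)`, `m` a layer with the decompositions
`U_m = U_∞·(V ∩ N)` (sibling §2) and `Gal(K̄/K_m) = H·U_m` (§1), and `g : U_m → M` additive with the
factorisation property of the sibling's `exists_extension` (`g u = f u'` whenever `u u'⁻¹ ∈ V`).  Then `g`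
is equivariant under conjugation by `Gal(K̄/K_m)`. [cite: SerreGaloisCohomology1997, I.§2.2 Prop. 8]
[cite: CoatesSujatha2005, §3 Lemma 3.8 (the `G`-equivariance of the unramified characters cut out by the fine Selmer group)] -/
theorem extension_equivariant [N.Normal] (V : Subgroup (absoluteGaloisGroup K)) [hVn : V.Normal]
    (M : Type) [AddCommGroup M] [DistribMulAction (absoluteGaloisGroup K) M]
    (hNM : ∀ σ ∈ N, ∀ x : M, σ • x = x)
    (f : ↥(N ⊓ κ.kerSubgroup) → M)
    (hfeq : ∀ h ∈ κ.kerSubgroup, ∀ u u' : ↥(N ⊓ κ.kerSubgroup),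
      (u' : absoluteGaloisGroup K) = h * u * h⁻¹ → f u' = h • f u)
    (m : ℕ) (hm : ∀ u ∈ N ⊓ κ.layerSubgroup m, ∃ v ∈ V ⊓ N, κ v = κ u)
    (hdec : ∀ γ ∈ κ.layerSubgroup m, ∃ w ∈ N ⊓ κ.layerSubgroup m, γ * w⁻¹ ∈ κ.kerSubgroup)
    (g : ↥(N ⊓ κ.layerSubgroup m) → M) (hgadd : ∀ a b, g (a * b) = g a + g b)
    (hg : ∀ (u : ↥(N ⊓ κ.layerSubgroup m)) (u' : ↥(N ⊓ κ.kerSubgroup)),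
      (u : absoluteGaloisGroup K) * (u' : absoluteGaloisGroup K)⁻¹ ∈ V → g u = f u')
    (γ : absoluteGaloisGroup K) (hγ : γ ∈ κ.layerSubgroup m)
    (u u'' : ↥(N ⊓ κ.layerSubgroup m)) (hu'' : (u'' : absoluteGaloisGroup K) = γ * u * γ⁻¹) :
    g u'' = γ • g u := by
  have hle : N ⊓ κ.kerSubgroup ≤ N ⊓ κ.layerSubgroup m :=
    inf_le_inf_left N (κ.kerSubgroup_le_layerSubgroup m)
  -- additivity consequences
  have hg1 : g 1 = 0 := by
    have h := hgadd 1 1; rw [mul_one] at h; exact left_eq_add.mp h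
  have hginv : ∀ a, g a⁻¹ = -g a := by
    intro a
    have h := hgadd a⁻¹ a
    rw [inv_mul_cancel, hg1] at h
    exact eq_neg_of_add_eq_zero_left h.symm
  -- `g` agrees with `f` on `U_∞`
  have hgf : ∀ x : ↥(N ⊓ κ.kerSubgroup), g (Subgroup.inclusion hle x) = f x := by
    intro x
    refine hg _ x ?_
    rw [Subgroup.coe_inclusion, mul_inv_cancel]
    exact V.one_mem
  -- decompose `u = u' v`
  obtain ⟨v, hv, hvu⟩ := hm u u.2
  obtain ⟨hvV, hvN⟩ := Subgroup.mem_inf.1 hv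
  have hu'mem : v⁻¹ * (u : absoluteGaloisGroup K) ∈ N ⊓ κ.kerSubgroup := by
    refine Subgroup.mem_inf.2 ⟨mul_mem (inv_mem hvN) (Subgroup.mem_inf.1 u.2).1, ?_⟩
    rw [ZpExtension.mem_kerSubgroup, map_mul, map_inv, hvu, inv_mul_cancel]
  set u' : ↥(N ⊓ κ.kerSubgroup) := ⟨v⁻¹ * (u : absoluteGaloisGroup K), hu'mem⟩ with hu'def
  have hrel : (u : absoluteGaloisGroup K) * (u' : absoluteGaloisGroup K)⁻¹ ∈ V := by
    have : (u : absoluteGaloisGroup K) * (u' : absoluteGaloisGroup K)⁻¹ = v := by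
      rw [hu'def, mul_inv_rev, inv_inv, mul_inv_cancel_left]
    rw [this]; exact hvV
  have hgu : g u = f u' := hg u u' hrel
  -- decompose `γ = γ₀ w`
  obtain ⟨w, hw, hγ₀⟩ := hdec γ hγ
  obtain ⟨γ₀, hγ₀def⟩ : ∃ γ₀ : absoluteGaloisGroup K, γ₀ = γ * w⁻¹ := ⟨_, rfl⟩
  have hγ₀ker : γ₀ ∈ κ.kerSubgroup := by rw [hγ₀def]; exact hγ₀
  have hγeq : γ = γ₀ * w := by rw [hγ₀def, inv_mul_cancel_right]
  have hwN : w ∈ N := (Subgroup.mem_inf.1 hw).1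
  -- the element `x = w u' w⁻¹ ∈ U_∞`, with `f x = f u'`
  have hxmem : w * (u' : absoluteGaloisGroup K) * w⁻¹ ∈ N ⊓ κ.kerSubgroup :=
    (inferInstance : (N ⊓ κ.kerSubgroup).Normal).conj_mem _ u'.2 w
  set x : ↥(N ⊓ κ.kerSubgroup) := ⟨w * (u' : absoluteGaloisGroup K) * w⁻¹, hxmem⟩ with hxdef
  have hfx : f x = f u' := by
    let wU : ↥(N ⊓ κ.layerSubgroup m) := ⟨w, hw⟩
    have hxU : Subgroup.inclusion hle x = wU * Subgroup.inclusion hle u' * wU⁻¹ := by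
      apply Subtype.ext
      simp only [Subgroup.coe_inclusion, Subgroup.coe_mul, Subgroup.coe_inv, hxdef]
      rfl
    rw [← hgf x, hxU, hgadd, hgadd, hginv, hgf u']
    abel
  -- `γ u' γ⁻¹ = γ₀ x γ₀⁻¹`
  have hconj_mem : γ * (u' : absoluteGaloisGroup K) * γ⁻¹ ∈ N ⊓ κ.kerSubgroup :=
    (inferInstance : (N ⊓ κ.kerSubgroup).Normal).conj_mem _ u'.2 γ
  have hfconj : f ⟨γ * (u' : absoluteGaloisGroup K) * γ⁻¹, hconj_mem⟩ = γ₀ • f x := by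
    refine hfeq γ₀ hγ₀ker x ⟨_, hconj_mem⟩ ?_
    change γ * (u' : absoluteGaloisGroup K) * γ⁻¹ = γ₀ * (w * (u' : absoluteGaloisGroup K) * w⁻¹) * γ₀⁻¹
    rw [hγeq]
    group
  -- `g u'' = f (γ u' γ⁻¹)`
  have hrel'' : (u'' : absoluteGaloisGroup K) * (γ * (u' : absoluteGaloisGroup K) * γ⁻¹)⁻¹ ∈ V := by
    rw [hu'']
    have : γ * (u : absoluteGaloisGroup K) * γ⁻¹ * (γ * (u' : absoluteGaloisGroup K) * γ⁻¹)⁻¹ =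
        γ * ((u : absoluteGaloisGroup K) * (u' : absoluteGaloisGroup K)⁻¹) * γ⁻¹ := by group
    rw [this]
    exact hVn.conj_mem _ hrel γ
  have hgu'' : g u'' = f ⟨γ * (u' : absoluteGaloisGroup K) * γ⁻¹, hconj_mem⟩ :=
    hg u'' ⟨_, hconj_mem⟩ hrel''
  -- assemble
  rw [hgu'', hfconj, hfx, ← hgu, hγeq, mul_smul, hNM w hwN]

/-! ## §3 Assembly: the equivariant count along the tower -/

/-- Every maximal ideal of `\bar ℤ_K` lies above a finite place of `K`. [folklore] -/
private theorem exists_mem_primesAbove_of_isMaximal₂ (𝔓 : Ideal (absIntegers (𝓞 K) K)) [h𝔓 : 𝔓.IsMaximal] :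
    ∃ v : HeightOneSpectrum (𝓞 K), 𝔓 ∈ v.primesAbove := by
  haveI : (𝔓.under (𝓞 K)).IsMaximal := Ideal.IsMaximal.under (𝓞 K) 𝔓
  have hne : 𝔓.under (𝓞 K) ≠ ⊥ :=
    Ring.ne_bot_of_isMaximal_of_not_isField inferInstance (RingOfIntegers.not_isField K)
  exact ⟨⟨𝔓.under (𝓞 K), inferInstance, hne⟩, h𝔓.isPrime, ⟨rfl⟩⟩

/-- **Equivariant everywhere-unramified `p`-torsion homomorphisms on `Gal(K̄/L·K_∞)` are bounded in number
by the `Gal(·/K_n)`-equivariant additive maps on the class groups of the layers `L·K_n`.**  For `K` a number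
field, `p` odd, `κ` a `ℤ_p`-extension with `H = ker κ`, `N = Gal(K̄/L)` open normal (`L ⊆ K̄` finite Galois
over `K`, `σ ∈ N ↔ σ` fixes `L`), `M` a finite `Γ_K`-module with `p·M = 0` on which `N` acts trivially:
if for every `n` the additive maps `μ : Cl(𝓞_{F_n}) → M` on `F_n = K̄^{N ∩ κ⁻¹(pⁿℤ_p)} = L·K_n` which are
equivariant under `Gal(K̄/K_n)` (`μ(γ|_{F_n} · c) = γ • μ(c)`) number at most `C`, then every finite set of
members of `unramifiedHoms (N ⊓ ker κ) M ∅` that are `H`-equivariant under conjugation has at most `C`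
elements.  (Isotypic form of the bounded-`p`-rank count of the sibling file.)
[cite: CoatesSujatha2005, §3 Lemma 3.8 and Thm. 3.4 (proof)] [cite: KuriharaPollack2007, §3.1]
[cite: Washington1997, §13.1 Prop. 13.2, Lemma 13.3] -/
theorem finsetCard_le_of_subset_equivariantUnramifiedHoms [N.Normal]
    (hN : IsOpen (N : Set (absoluteGaloisGroup K))) (hp : p ≠ 2)
    (M : Type) [AddCommGroup M] [Finite M] [TopologicalSpace M] [DiscreteTopology M]
    [DistribMulAction (absoluteGaloisGroup K) M] (hNM : ∀ σ ∈ N, ∀ x : M, σ • x = x)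
    (hpM : ∀ x : M, p • x = 0) (C : ℕ)
    (hC : ∀ n : ℕ,
      haveI : IsGalois K (fixedField (N ⊓ κ.layerSubgroup n) : IntermediateField K (AlgebraicClosure K)) :=
        isGalois_fixedField_inf_layerSubgroup κ N hN n
      Nat.card {μ : Additive (ClassGroup (𝓞 (fixedField (N ⊓ κ.layerSubgroup n) :
          IntermediateField K (AlgebraicClosure K)))) →+ M //
        ∀ γ ∈ κ.layerSubgroup n, ∀ c,
          μ (Additive.ofMul (ClassGroup.mulEquiv (AmbiguousClass.intAut
            (absRestrictNormalHom (fixedField (N ⊓ κ.layerSubgroup n) :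
              IntermediateField K (AlgebraicClosure K)) γ)) c)) = γ • μ (Additive.ofMul c)} ≤ C)
    (T : Finset (↥(N ⊓ κ.kerSubgroup) → M))
    (hT : (T : Set (↥(N ⊓ κ.kerSubgroup) → M)) ⊆
      unramifiedHoms (N ⊓ κ.kerSubgroup) M (∅ : Set (HeightOneSpectrum (𝓞 K))))
    (hTeq : ∀ f ∈ T, ∀ h ∈ κ.kerSubgroup, ∀ u u' : ↥(N ⊓ κ.kerSubgroup),
      (u' : absoluteGaloisGroup K) = h * u * h⁻¹ → f u' = h • f u) :
    T.card ≤ C := by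
  have hpr : p.Prime := Fact.out
  -- §1 (sibling): a common open normal `V` on which all `f ∈ T` vanish
  obtain ⟨V, hV⟩ := exists_openNormalSubgroup_forall_apply_eq_zero (N ⊓ κ.kerSubgroup) M T
    (fun f hf => (hT hf).1)
    (fun f hf => by
      have h := (hT hf).2.1 1 1
      rw [mul_one, left_eq_add] at h
      exact h)
  set V' : Subgroup (absoluteGaloisGroup K) := (V : Subgroup (absoluteGaloisGroup K)) with hV'def
  haveI hV'n : V'.Normal := V.isNormal'
  have hV'open : IsOpen (V' : Set (absoluteGaloisGroup K)) := V.isOpen'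
  -- §2 (sibling): the decomposition layer `t`; §1 (here): the layer `t'`
  obtain ⟨t, ht⟩ := exists_level_forall_exists_apply_eq κ N hN V' hV'open
  obtain ⟨t', ht'⟩ := exists_level_forall_exists_mul_mem_kerSubgroup κ N hN
  -- §4 (sibling): the absorption layers above `p`
  have hPfin : {v : HeightOneSpectrum (𝓞 K) | ((p : ℕ) : 𝓞 K) ∈ v.asIdeal}.Finite := by
    have hp0 : (Ideal.span {((p : ℕ) : 𝓞 K)} : Ideal (𝓞 K)) ≠ ⊥ := by
      rw [Ne, Ideal.span_singleton_eq_bot]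
      exact_mod_cast hpr.ne_zero
    refine (Ideal.finite_factors hp0).subset fun v hv => ?_
    exact (Ideal.dvd_span_singleton.2 hv : v.asIdeal ∣ Ideal.span {((p : ℕ) : 𝓞 K)})
  have habs : ∀ v : HeightOneSpectrum (𝓞 K), ∃ mv : ℕ, t ≤ mv ∧ ∀ m, mv ≤ m → ∀ 𝔓 ∈ v.primesAbove,
      ∀ j ∈ N ⊓ κ.layerSubgroup m, j ∈ 𝔓.inertia (absoluteGaloisGroup K) →
        κ j = 1 ∨ ∃ j₁ ∈ N ⊓ κ.layerSubgroup t,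
          j₁ ∈ 𝔓.inertia (absoluteGaloisGroup K) ∧ κ j = κ (j₁ ^ p) :=
    fun v => exists_level_absorb_at κ N hN v t
  choose mv hmvt hmv using habs
  obtain ⟨m₁, hm₁t, hm₁t', hm₁v⟩ : ∃ m₁ : ℕ, t ≤ m₁ ∧ t' ≤ m₁ ∧
      ∀ v : HeightOneSpectrum (𝓞 K), ((p : ℕ) : 𝓞 K) ∈ v.asIdeal → mv v ≤ m₁ :=
    ⟨max (max t t') (hPfin.toFinset.sup mv), (le_max_left _ _).trans (le_max_left _ _),
      (le_max_right _ _).trans (le_max_left _ _), fun v hv =>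
      (Finset.le_sup (f := mv) (hPfin.mem_toFinset.2 hv)).trans (le_max_right _ _)⟩
  -- §3 (sibling): the extensions at level `t`, restricted to level `m₁`
  have hext : ∀ f ∈ T, ∃ g : ↥(N ⊓ κ.layerSubgroup t) → M,
      (∀ a b, g (a * b) = g a + g b) ∧
      (∀ (u : ↥(N ⊓ κ.layerSubgroup t)) (u' : ↥(N ⊓ κ.kerSubgroup)),
        (u : absoluteGaloisGroup K) * (u' : absoluteGaloisGroup K)⁻¹ ∈ V' → g u = f u') :=
    fun f hf => exists_extension κ N V' M f (hT hf).2.1 (hV f hf) t (ht t le_rfl)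
  obtain ⟨gext, hgadd, hgfac⟩ : ∃ gext : (↥(N ⊓ κ.kerSubgroup) → M) → (↥(N ⊓ κ.layerSubgroup t) → M),
      (∀ f ∈ T, ∀ a b, gext f (a * b) = gext f a + gext f b) ∧
      (∀ f ∈ T, ∀ (u : ↥(N ⊓ κ.layerSubgroup t)) (u' : ↥(N ⊓ κ.kerSubgroup)),
        (u : absoluteGaloisGroup K) * (u' : absoluteGaloisGroup K)⁻¹ ∈ V' → gext f u = f u') := by
    choose! gext hgadd hgfac using hext
    exact ⟨gext, hgadd, hgfac⟩
  set U : Subgroup (absoluteGaloisGroup K) := N ⊓ κ.layerSubgroup m₁ with hUdef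
  have hUt : U ≤ N ⊓ κ.layerSubgroup t :=
    inf_le_inf_left N (κ.layerSubgroup_antitone hm₁t)
  haveI hUn : U.Normal := inferInstance
  have hUopen : IsOpen (U : Set (absoluteGaloisGroup K)) := hN.inter (κ.isOpen_layerSubgroup m₁)
  set W : Subgroup (absoluteGaloisGroup K) := V' ⊓ U with hWdef
  haveI hWn : W.Normal := inferInstance
  have hWopen : IsOpen (W : Set (absoluteGaloisGroup K)) := hV'open.inter hUopen
  have hWU : W ≤ U := inf_le_right
  obtain ⟨G, hG⟩ : ∃ G : (↥(N ⊓ κ.kerSubgroup) → M) → (U → M),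
      ∀ f u, G f u = gext f (Subgroup.inclusion hUt u) := ⟨_, fun _ _ => rfl⟩
  -- factorisation property of `G f` at level `m₁`
  have hGfac : ∀ f ∈ T, ∀ (u : U) (u' : ↥(N ⊓ κ.kerSubgroup)),
      (u : absoluteGaloisGroup K) * (u' : absoluteGaloisGroup K)⁻¹ ∈ V' → G f u = f u' := by
    intro f hf u u' hu
    rw [hG]
    refine hgfac f hf _ u' ?_
    rw [Subgroup.coe_inclusion]
    exact hu
  -- the extended maps restrict to the given ones: `G` is injective on `T`
  have hGres : ∀ f ∈ T, ∀ (u' : ↥(N ⊓ κ.kerSubgroup)) (hu : (u' : absoluteGaloisGroup K) ∈ U),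
      G f ⟨u', hu⟩ = f u' := by
    intro f hf u' hu
    refine hGfac f hf _ u' ?_
    rw [mul_inv_cancel]
    exact V'.one_mem
  have hGinj : Set.InjOn G T := by
    intro f₁ hf₁ f₂ hf₂ h
    funext u'
    have hu : ((u' : ↥(N ⊓ κ.kerSubgroup)) : absoluteGaloisGroup K) ∈ U :=
      Subgroup.mem_inf.2 ⟨(Subgroup.mem_inf.1 u'.2).1,
        κ.kerSubgroup_le_layerSubgroup m₁ (Subgroup.mem_inf.1 u'.2).2⟩
    rw [← hGres f₁ hf₁ u' hu, ← hGres f₂ hf₂ u' hu, h]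
  -- every `G f` is additive, kills `W` and every `U ∩ I_𝔓`
  have hGadd : ∀ g ∈ T.image G, ∀ u v : U, g (u * v) = g u + g v := by
    intro g hg u v
    obtain ⟨f, hf, rfl⟩ := Finset.mem_image.1 hg
    rw [hG, hG, hG, map_mul]
    exact hgadd f hf _ _
  have hGW : ∀ g ∈ T.image G, ∀ u : U, (u : absoluteGaloisGroup K) ∈ W → g u = 0 := by
    intro g hg u hu
    obtain ⟨f, hf, rfl⟩ := Finset.mem_image.1 hg
    have h1 : G f u = f 1 := by
      refine hGfac f hf _ 1 ?_
      rw [Subgroup.coe_one, inv_one, mul_one]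
      exact (Subgroup.mem_inf.1 hu).1
    rw [h1]
    have h := (hT hf).2.1 1 1
    rw [mul_one, left_eq_add] at h
    exact h
  have hGI : ∀ g ∈ T.image G, ∀ (𝔓 : Ideal (absIntegers (𝓞 K) K)), 𝔓.IsMaximal →
      ∀ u : U, (u : absoluteGaloisGroup K) ∈ 𝔓.inertia (absoluteGaloisGroup K) → g u = 0 := by
    intro g hg 𝔓 h𝔓max u hu
    obtain ⟨f, hf, rfl⟩ := Finset.mem_image.1 hg
    obtain ⟨v, h𝔓⟩ := exists_mem_primesAbove_of_isMaximal₂ 𝔓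
    rw [hG]
    have hcoe : ((Subgroup.inclusion hUt u : ↥(N ⊓ κ.layerSubgroup t)) : absoluteGaloisGroup K) =
        (u : absoluteGaloisGroup K) := Subgroup.coe_inclusion hUt u
    have hu' : ((Subgroup.inclusion hUt u : ↥(N ⊓ κ.layerSubgroup t)) : absoluteGaloisGroup K) ∈
        𝔓.inertia (absoluteGaloisGroup K) := by rw [hcoe]; exact hu
    by_cases hv : ((p : ℕ) : 𝓞 K) ∈ v.asIdeal
    · have habs := hmv v m₁ (hm₁v v hv) 𝔓 h𝔓 u u.2 hu
      rw [← hcoe] at habs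
      exact extension_apply_eq_zero_of_absorb κ N V' M hpM f (hT hf) t (gext f) (hgadd f hf) (hgfac f hf)
        h𝔓 (Subgroup.inclusion hUt u) hu' habs
    · exact extension_apply_eq_zero_of_not_mem κ N V' M f (hT hf) t (gext f) (hgfac f hf) hv h𝔓
        (Subgroup.inclusion hUt u) hu'
  -- §2 (here): every `G f` is `Gal(K̄/K_{m₁})`-equivariant
  have hGeq : ∀ g ∈ T.image G, ∀ γ ∈ κ.layerSubgroup m₁, ∀ u u' : U,
      (u' : absoluteGaloisGroup K) = γ * u * γ⁻¹ → g u' = γ • g u := by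
    intro g hg γ hγ u u' hu'
    obtain ⟨f, hf, rfl⟩ := Finset.mem_image.1 hg
    exact extension_equivariant κ N V' M hNM f (hTeq f hf) m₁ (ht m₁ hm₁t) (ht' m₁ hm₁t') (G f)
      (fun a b => by rw [hG, hG, hG, map_mul]; exact hgadd f hf _ _) (hGfac f hf) γ hγ u u' hu'
  -- §5: the EQUIVARIANT class-field-theoretic count
  haveI hFgal : IsGalois K (fixedField U : IntermediateField K (AlgebraicClosure K)) :=
    isGalois_fixedField_inf_layerSubgroup κ N hN m₁
  haveI : FiniteDimensional K (fixedField U : IntermediateField K (AlgebraicClosure K)) :=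
    finiteDimensional_fixedField_of_isOpen U hUopen
  have hUL : ∀ σ : absoluteGaloisGroup K, σ ∈ U ↔
      absRestrictNormalHom (fixedField U : IntermediateField K (AlgebraicClosure K)) σ = 1 := by
    intro σ
    rw [absRestrictNormalHom_eq_one_iff]
    exact (SetLike.ext_iff.mp (fixingSubgroup_fixedField_of_isOpen U hUopen) σ).symm
  have hcount := EquivariantUnramifiedDescent.card_le_card_equivariantHom_classGroup_of_unramified p U W hp
    (fixedField U : IntermediateField K (AlgebraicClosure K)) hUL hWopen hWU (κ.layerSubgroup m₁) M hpM
    (T.image G) hGadd hGeq hGW hGI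
  rw [Finset.card_image_of_injOn hGinj] at hcount
  exact hcount.trans (hC m₁)

/-- **Corollary.** Under the hypotheses of `finsetCard_le_of_subset_equivariantUnramifiedHoms`, the set of
`H`-equivariant members of `unramifiedHoms (N ⊓ ker κ) M ∅` is FINITE.
[cite: CoatesSujatha2005, §3 Lemma 3.8 and Thm. 3.4 (proof)] [cite: KuriharaPollack2007, §3.1] -/
theorem equivariantUnramifiedHoms_finite_of_card_le [N.Normal]
    (hN : IsOpen (N : Set (absoluteGaloisGroup K))) (hp : p ≠ 2)
    (M : Type) [AddCommGroup M] [Finite M] [TopologicalSpace M] [DiscreteTopology M]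
    [DistribMulAction (absoluteGaloisGroup K) M] (hNM : ∀ σ ∈ N, ∀ x : M, σ • x = x)
    (hpM : ∀ x : M, p • x = 0) (C : ℕ)
    (hC : ∀ n : ℕ,
      haveI : IsGalois K (fixedField (N ⊓ κ.layerSubgroup n) : IntermediateField K (AlgebraicClosure K)) :=
        isGalois_fixedField_inf_layerSubgroup κ N hN n
      Nat.card {μ : Additive (ClassGroup (𝓞 (fixedField (N ⊓ κ.layerSubgroup n) :
          IntermediateField K (AlgebraicClosure K)))) →+ M //
        ∀ γ ∈ κ.layerSubgroup n, ∀ c,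
          μ (Additive.ofMul (ClassGroup.mulEquiv (AmbiguousClass.intAut
            (absRestrictNormalHom (fixedField (N ⊓ κ.layerSubgroup n) :
              IntermediateField K (AlgebraicClosure K)) γ)) c)) = γ • μ (Additive.ofMul c)} ≤ C) :
    {f ∈ unramifiedHoms (N ⊓ κ.kerSubgroup) M (∅ : Set (HeightOneSpectrum (𝓞 K))) |
      ∀ h ∈ κ.kerSubgroup, ∀ u u' : ↥(N ⊓ κ.kerSubgroup),
        (u' : absoluteGaloisGroup K) = h * u * h⁻¹ → f u' = h • f u}.Finite := by
  by_contra hinf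
  obtain ⟨T, hTsub, hTcard⟩ := Set.Infinite.exists_subset_card_eq hinf (C + 1)
  have h := finsetCard_le_of_subset_equivariantUnramifiedHoms κ N hN hp M hNM hpM C hC T
    (fun f hf => (hTsub hf).1) (fun f hf => (hTsub hf).2)
  omega

end Literature.NumberTheory.IwasawaTheory.EquivariantUnramifiedHomsZpTowerFinite

end
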